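import Mathlib.Data.Nat.Squarefree
import Mathlib.Data.Rat.Sqrt
import Mathlib.Tactic
import HarnessLib

/-!
# Route `PrintCf2`, crux stmt-BirchSwinnertonDyer-20509 `RamifiedOffTYZOfFacts` — THE INVISIBLE GENERATOR, part 1 (arithmetic): on the conic
# `s⁴ + n² = 2w²` the number `2w + s² + n` is a square times a divisor of `2n`
# (cell `bsd-print-cf2`, LEAD of 20509 g18, line `offtyz-v7`, lineage cycle 19; fact-free, Theses-free, no `def`)

HONEST FRAMING (crux 20509 = `𝔅_ram → WAllCornerFTwoRamifiedOffTYZProved`, DECIDING, OPEN AS A CLASS; C⁺ = `stub_offTYZ_levelTwoScriptLExact` = item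
stmt-BirchSwinnertonDyer-23431, OPEN).  Elementary arithmetic over `ℚ`/`ℕ` (lowest terms, parity, one gcd argument, the square-free part of an
integer via `Nat.sq_mul_squarefree_of_pos` and `Nat.factorization`); no curve, no field, nothing asserted, no named fact.  It is the number-theoretic
input of part 2 (`…InvisibleGenerator`), which proves the GENERATOR half of the LEAD g17 census law (GP): «the `2`-isogeny descent class of the
`A_n`-generator is `d(h) = 2` ⟹ `α_n` is `2`-divisible in `A(ℍ′_n)` modulo torsion».

* `even_of_two_mul_sq_eq_natCast` (`2v² = E ∈ ℕ`, `v ∈ ℚ` ⟹ `E` even), `eq_natSqrt_of_sq_eq_natCast` (a non-negative rational with square in `ℕ` is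
  a natural number);
* ★ `exists_dvd_two_mul_and_eq_mul_sq` — **square-free `n > 1`, rationals `s`, `w > 0` with `2w² = s⁴ + n²` ⟹ `2w + s² + n = u·t²` with `u ∣ 2n`,
  `t ∈ ℚ`.**  PROOF: `s = S/Q` in lowest terms, `w = W/Q²` with `W ∈ ℕ`, `C := 2W + S² + nQ²`, `C′ := 2W − S² − nQ² > 0` (`n` is not a square),
  `C·C′ = (S² − nQ²)²`; an odd prime dividing `C` and `C′` divides `4W`, `2(S² + nQ²)` and `S² − nQ²`, hence `S` and `Q` — impossible — or `n`; a
  prime `r ∤ 2n` dividing the square-free part `u` of `C` divides `C` to an odd power, hence (the product being a square) `C′` too: contradiction.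
  (Equivalently: in `ℚ(i)`, `(s² + ni)(1 − i) = γ²/(2(2w + s² + n))` with `γ = (2w + s² + n) + (n − s²)i` — Hilbert 90 made explicit — so the
  theorem says `[s² + ni] ∈ [1 ± i]·⟨2, p ∣ n⟩` in `ℚ(i)^×/□`, WITHOUT Gaussian-integer factorisation.)

Beyond-print theorem: NO (arithmetic lemma).  BSD is not proved by any of this; no class is closed by this file.

References: [cite: TianYuanZhang2017, §1 (arXiv:1411.4728 chunk p0002 L101–L110: `ρ(n)`, `φ_n : A_n → E_n`), §3.1 (p0011 L27–L36: `A(K_n)⁻`, `α_n`;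
p0011 L58–L66: `ℍ′_n ⊇ L_n(i) = ℚ(i, √d : d ∣ n)`), §3.2 (p0012 L12–L18: `τ`), Thm. 3.5 (p0011 L94–L100), Lemma 3.16 (p0017 L98–L113), Lemma 3.18
(p0017 L152–L153)]; [cite: SilvermanAEC2009, Prop. X.1.4 (complete `2`-descent), Prop. X.4.9]; [cite: Darmon2004, Thm. 3.22] (GZK, binder `hGZK`);
[cite: Lang2002, VI §1 Thm. 1.2, Cor. 1.4]; tree: `Literature/…/TwoDescent` (`twoDescentComponent_add`, `exists_add_self_of_twoDescentComponent_eq_one`),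
`…VisibleGenerator` (g16: `splitTwoTorsion_curveA`, the converse direction), `…LowerHalfVisibleSeven` (g16: `exists_map_ΘA_eq_some`, `Atwo_equation`,
`generatesFreePart_ΘA`), `…LevelTwoRhoValve` (g3), `…LevelTwoDepth` (g3), `…GeneratorDepth{,RhoOne}` (this seat, cycle 19), LEAD memo
`Cruxes/RamifiedOffTYZOfFacts/Lines/offtyz_v7_GeneratorDepth.md` §4–§6.
-/

noncomputable section

open scoped Classical

set_option autoImplicit false

namespace Summit.BirchSwinnertonDyer.PrintCf2.InvisibleGenerator

/-! ## §1 Arithmetic: `2w² = s⁴ + n²` forces `2w + s² + n ∈ u·ℚ^{×2}` with `u ∣ 2n` -/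

/-- If `2v² = E` for a rational `v` and a natural number `E`, then `E` is even. [folklore] -/
theorem even_of_two_mul_sq_eq_natCast {v : ℚ} {E : ℕ} (h : 2 * v ^ 2 = (E : ℚ)) : Even E := by
  -- `2·num² = E·den²` in `ℤ`
  have hden : (v.den : ℚ) ≠ 0 := by exact_mod_cast v.den_ne_zero
  have hv : v = (v.num : ℚ) / (v.den : ℚ) := (Rat.num_div_den v).symm
  have hZ : (2 * v.num ^ 2 : ℤ) = (E : ℤ) * (v.den : ℤ) ^ 2 := by
    have hq : (2 : ℚ) * (v.num : ℚ) ^ 2 = (E : ℚ) * (v.den : ℚ) ^ 2 := by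
      rw [hv] at h
      field_simp at h
      linear_combination h
    exact_mod_cast hq
  have hcop : v.num.natAbs.Coprime v.den := v.reduced
  rcases Nat.even_or_odd v.den with hde | hdo
  · -- `den` even ⟹ `num` even ⟹ contradiction
    exfalso
    obtain ⟨d, hd⟩ := hde
    have h4 : (4 : ℤ) ∣ 2 * v.num ^ 2 := ⟨(E : ℤ) * (d : ℤ) ^ 2, by rw [hZ, hd]; push_cast; ring⟩
    have h2 : (2 : ℤ) ∣ v.num ^ 2 := by
      obtain ⟨m, hm⟩ := h4
      exact ⟨m, by omega⟩
    have hnum : (2 : ℤ) ∣ v.num := Int.prime_two.dvd_of_dvd_pow h2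
    have hnat : 2 ∣ v.num.natAbs := Int.natAbs_dvd_natAbs.mpr hnum
    have hden2 : 2 ∣ v.den := ⟨d, by omega⟩
    have h21 : 2 = 1 := Nat.eq_one_of_dvd_coprimes hcop hnat hden2
    omega
  · -- `den` odd ⟹ `E·den²` even ⟹ `E` even
    have hev : Even ((E : ℤ) * (v.den : ℤ) ^ 2) := ⟨v.num ^ 2, by rw [← hZ]; ring⟩
    rcases Int.even_mul.mp hev with hE | hd2
    · exact_mod_cast (Int.even_coe_nat E).mp hE
    · exfalso
      have : Odd ((v.den : ℤ) ^ 2) := by exact_mod_cast hdo.pow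
      exact Int.not_even_iff_odd.mpr this hd2


/-- A non-negative rational whose square is a natural number `m` is the natural number `√m`. [folklore] -/
theorem eq_natSqrt_of_sq_eq_natCast {v : ℚ} {m : ℕ} (h : v ^ 2 = (m : ℚ)) (hv : 0 ≤ v) :
    v = (Nat.sqrt m : ℚ) ∧ Nat.sqrt m ^ 2 = m := by
  have h1 : Rat.sqrt (v * v) = |v| := Rat.sqrt_eq v
  rw [← pow_two, h, Rat.sqrt_natCast, abs_of_nonneg hv] at h1
  refine ⟨h1.symm, ?_⟩
  have h2 : ((Nat.sqrt m : ℕ) : ℚ) ^ 2 = (m : ℚ) := by rw [h1, h]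
  exact_mod_cast h2

/-- A square-free natural number `> 1` is not the square of a rational number. [folklore] -/
private theorem not_sq_eq_natCast_of_squarefree' {n : ℕ} (hsq : Squarefree n) (hn1 : 1 < n) (q : ℚ) :
    q ^ 2 ≠ (n : ℚ) := by
  intro h
  have hsqQ : IsSquare (n : ℚ) := ⟨q, by rw [← h, sq]⟩
  obtain ⟨m, hm⟩ := Rat.isSquare_natCast_iff.1 hsqQ
  have hmu : IsUnit m := hsq m ⟨1, by rw [mul_one]; exact hm⟩
  rw [Nat.isUnit_iff] at hmu
  subst hmu
  omega

variable {n : ℕ}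

/-- **THE ARITHMETIC CORE.**  For square-free odd `n > 1` and rationals `s ≠ 0`, `w > 0` with `2w² = s⁴ + n²` (the curve equation of
`A_n : Y² = X³ + 4n²X` at `X = 2s²`, `w = |Y/(4s)|`), the positive rational `c := 2w + s² + n` lies in `u·ℚ^{×2}` for a divisor `u` of `2n`.
(Integers: `s = S/Q` in lowest terms, `w = W/Q²`, `C = 2W + S² + nQ²`, `C′ = 2W − S² − nQ² > 0`, `C·C′ = (S² − nQ²)²`; an odd prime dividing
both `C` and `C′` divides `W`, `S² ± nQ²`, hence `S` and `Q` — impossible — so it divides `n`; a prime dividing the square-free part of `C` divides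
`C` to an odd power, hence `C′` too.) [folklore] -/
theorem exists_dvd_two_mul_and_eq_mul_sq (hsq : Squarefree n) (hn1 : 1 < n) {s w : ℚ}
    (hw : 0 < w) (h : 2 * w ^ 2 = s ^ 4 + (n : ℚ) ^ 2) :
    ∃ (u : ℕ) (t : ℚ), u ∣ 2 * n ∧ 2 * w + s ^ 2 + n = u * t ^ 2 := by
  -- integers `S, Q` with `s² = S²/Q²`, `gcd(S, Q) = 1`
  set S : ℕ := s.num.natAbs with hSdef
  set Q : ℕ := s.den with hQdef
  have hQ0 : 0 < Q := s.den_pos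
  have hQq : (Q : ℚ) ≠ 0 := by exact_mod_cast hQ0.ne'
  have hcop : S.Coprime Q := s.reduced
  have hsq2 : s ^ 2 * (Q : ℚ) ^ 2 = (S : ℚ) ^ 2 := by
    have e1 : s * (Q : ℚ) = (s.num : ℚ) := by rw [hQdef]; exact Rat.mul_den_eq_num s
    have e2 : ((S : ℕ) : ℚ) = |(s.num : ℚ)| := by
      rw [hSdef, Nat.cast_natAbs, Int.cast_abs]
    rw [e2, sq_abs, ← e1]; ring
  -- `E = S⁴ + n²Q⁴ = 2 (wQ²)²` is even; `W = wQ²` is a natural number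
  set E : ℕ := S ^ 4 + n ^ 2 * Q ^ 4 with hEdef
  have hE : 2 * (w * (Q : ℚ) ^ 2) ^ 2 = (E : ℚ) := by
    rw [hEdef]; push_cast
    have : (S : ℚ) ^ 4 = (s ^ 2 * (Q : ℚ) ^ 2) ^ 2 := by rw [hsq2]; ring
    rw [this]; linear_combination (Q : ℚ) ^ 4 * h
  obtain ⟨E2, hE2⟩ := even_of_two_mul_sq_eq_natCast hE
  have hW2 : (w * (Q : ℚ) ^ 2) ^ 2 = (E2 : ℚ) := by
    have : (E : ℚ) = 2 * (E2 : ℚ) := by rw [hE2]; push_cast; ring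
    linear_combination (hE.trans this) / 2
  obtain ⟨hWeq, hWsq⟩ := eq_natSqrt_of_sq_eq_natCast hW2 (by positivity)
  set W : ℕ := Nat.sqrt E2 with hWdef
  have h2W : 2 * W ^ 2 = S ^ 4 + n ^ 2 * Q ^ 4 := by rw [hWsq]; omega
  -- `S² ≠ nQ²`, so `2W > S² + nQ²`
  have hne : (S : ℤ) ^ 2 ≠ (n : ℤ) * (Q : ℤ) ^ 2 := by
    intro heq
    apply not_sq_eq_natCast_of_squarefree' hsq hn1 ((S : ℚ) / (Q : ℚ))
    have heqQ : ((S : ℚ)) ^ 2 = (n : ℚ) * (Q : ℚ) ^ 2 := by exact_mod_cast heq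
    rw [div_pow, heqQ, mul_div_assoc, div_self (pow_ne_zero 2 hQq), mul_one]
  have hlt : S ^ 2 + n * Q ^ 2 < 2 * W := by
    have h2WZ : 2 * (W : ℤ) ^ 2 = (S : ℤ) ^ 4 + (n : ℤ) ^ 2 * (Q : ℤ) ^ 4 := by exact_mod_cast h2W
    have hD : 0 < ((S : ℤ) ^ 2 - n * Q ^ 2) ^ 2 := by
      have hne' : (S : ℤ) ^ 2 - n * Q ^ 2 ≠ 0 := sub_ne_zero.mpr hne
      positivity
    have hsqN : (S ^ 2 + n * Q ^ 2) ^ 2 < (2 * W) ^ 2 := by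
      have : ((S ^ 2 + n * Q ^ 2 : ℕ) : ℤ) ^ 2 < ((2 * W : ℕ) : ℤ) ^ 2 := by
        push_cast; nlinarith [h2WZ, hD]
      exact_mod_cast this
    exact (Nat.pow_lt_pow_iff_left two_ne_zero).mp hsqN
  -- `C = 2W + S² + nQ²`, `C′ = 2W − (S² + nQ²) > 0`, `C·C′ = (S² − nQ²)²`
  set A : ℕ := S ^ 2 + n * Q ^ 2 with hAdef
  set C : ℕ := 2 * W + A with hCdef
  set C' : ℕ := 2 * W - A with hC'def
  set Dz : ℤ := (S : ℤ) ^ 2 - n * Q ^ 2 with hDzdef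
  have hC0 : 0 < C := by omega
  have hC'0 : 0 < C' := by omega
  have hCadd : C = C' + 2 * A := by omega
  have hCC'Z : (C : ℤ) * (C' : ℤ) = Dz ^ 2 := by
    have h2WZ : 2 * (W : ℤ) ^ 2 = (S : ℤ) ^ 4 + (n : ℤ) ^ 2 * (Q : ℤ) ^ 4 := by exact_mod_cast h2W
    have hC'Z : ((C' : ℕ) : ℤ) = 2 * (W : ℤ) - ((S : ℤ) ^ 2 + n * Q ^ 2) := by
      rw [hC'def, Nat.cast_sub hlt.le]; push_cast; rw [hAdef]; push_cast; ring
    rw [hC'Z, hCdef, hAdef, hDzdef]; push_cast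
    linear_combination 2 * h2WZ
  have hCC' : C * C' = Dz.natAbs ^ 2 := by
    have : ((C * C' : ℕ) : ℤ) = ((Dz.natAbs ^ 2 : ℕ) : ℤ) := by
      push_cast; rw [sq_abs, hCC'Z]
    exact_mod_cast this
  have hDz0 : Dz.natAbs ≠ 0 := by
    rw [Ne, Int.natAbs_eq_zero, hDzdef, sub_eq_zero]; exact hne
  -- KEY: an odd prime dividing both `C` and `C′` divides `n`
  have hkey : ∀ r : ℕ, r.Prime → r ≠ 2 → r ∣ C → r ∣ C' → r ∣ n := by
    intro r hr hr2 hrC hrC'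
    have hr2' : Nat.Coprime r 2 := (Nat.coprime_primes hr Nat.prime_two).mpr hr2
    -- `r ∣ A`
    have hrA : r ∣ A := by
      have h2A : r ∣ 2 * A := by
        have : r ∣ C' + 2 * A := by rw [← hCadd]; exact hrC
        exact (Nat.dvd_add_right hrC').mp this
      exact hr2'.dvd_of_dvd_mul_left h2A
    -- `r ∣ |S² − nQ²|`
    have hrD : r ∣ Dz.natAbs := by
      have : r ∣ Dz.natAbs ^ 2 := by rw [← hCC']; exact Dvd.dvd.mul_right hrC _
      exact hr.dvd_of_dvd_pow this
    -- hence `r ∣ 2S²` and `r ∣ 2nQ²` (in `ℤ`, then back)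
    have hrAz : (r : ℤ) ∣ (S : ℤ) ^ 2 + n * Q ^ 2 := by
      have : (r : ℤ) ∣ ((A : ℕ) : ℤ) := Int.natCast_dvd_natCast.mpr hrA
      rw [hAdef] at this; push_cast at this; exact this
    have hrDz : (r : ℤ) ∣ Dz := Int.natCast_dvd.mpr hrD
    have hS2 : r ∣ 2 * S ^ 2 := by
      have : (r : ℤ) ∣ 2 * (S : ℤ) ^ 2 := by
        have h' := dvd_add hrAz hrDz
        rw [hDzdef, show (S : ℤ) ^ 2 + n * Q ^ 2 + ((S : ℤ) ^ 2 - n * Q ^ 2) = 2 * (S : ℤ) ^ 2 by ring] at h'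
        exact h'
      exact_mod_cast this
    have hQ2 : r ∣ 2 * (n * Q ^ 2) := by
      have : (r : ℤ) ∣ 2 * ((n : ℤ) * (Q : ℤ) ^ 2) := by
        have h' := dvd_sub hrAz hrDz
        rw [hDzdef, show (S : ℤ) ^ 2 + n * Q ^ 2 - ((S : ℤ) ^ 2 - n * Q ^ 2) = 2 * ((n : ℤ) * (Q : ℤ) ^ 2) by ring] at h'
        exact h'
      exact_mod_cast this
    have hrS : r ∣ S := hr.dvd_of_dvd_pow (hr2'.dvd_of_dvd_mul_left hS2)
    rcases (Nat.Prime.dvd_mul hr).mp (hr2'.dvd_of_dvd_mul_left hQ2) with hrn | hrQ2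
    · exact hrn
    · exfalso
      have hrQ : r ∣ Q := hr.dvd_of_dvd_pow hrQ2
      have := Nat.eq_one_of_dvd_coprimes hcop hrS hrQ
      exact hr.one_lt.ne' this
  -- the square-free part `u` of `C` divides `2n`
  obtain ⟨u, b, hu0, hb0, hCub, husq⟩ := Nat.sq_mul_squarefree_of_pos hC0
  have hu2n : u ∣ 2 * n := by
    have h2n0 : 2 * n ≠ 0 := by omega
    rw [← Nat.factorization_le_iff_dvd hu0.ne' h2n0]
    intro r
    by_cases hru : r ∣ u ∧ r.Prime
    · obtain ⟨hru, hr⟩ := hru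
      have hu1 : u.factorization r ≤ 1 := (Nat.squarefree_iff_factorization_le_one hu0.ne').mp husq r
      -- `r ∣ 2n`
      have hr2n : r ∣ 2 * n := by
        by_cases hr2 : r = 2
        · rw [hr2]; exact dvd_mul_right 2 n
        · have hrC : r ∣ C := by rw [← hCub]; exact Dvd.dvd.mul_left hru _
          -- `v_r(C)` is odd, so `v_r(C′)` is odd, so `r ∣ C′`
          have hvu : u.factorization r = 1 :=
            le_antisymm hu1 ((hr.dvd_iff_one_le_factorization hu0.ne').mp hru)
          have hvC : C.factorization r = 2 * b.factorization r + 1 := by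
            rw [← hCub, Nat.factorization_mul (pow_ne_zero 2 hb0.ne') hu0.ne', Nat.factorization_pow]
            simp [hvu]
          have hvCC' : C.factorization r + C'.factorization r = 2 * (Dz.natAbs).factorization r := by
            have := congrArg (fun m => m.factorization r) hCC'
            simp only [Nat.factorization_mul hC0.ne' hC'0.ne', Nat.factorization_pow, Finsupp.coe_add, Pi.add_apply,
              Finsupp.coe_smul, Pi.smul_apply, smul_eq_mul] at this
            exact this
          have hvC' : C'.factorization r ≠ 0 := by omega
          have hrC' : r ∣ C' := Nat.dvd_of_factorization_pos hvC'
          exact Dvd.dvd.mul_left (hkey r hr hr2 hrC hrC') 2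
      have : 1 ≤ (2 * n).factorization r := (hr.dvd_iff_one_le_factorization h2n0).mp hr2n
      omega
    · have : u.factorization r = 0 := by
        rcases not_and_or.mp hru with h1 | h2
        · exact Nat.factorization_eq_zero_of_not_dvd h1
        · exact Nat.factorization_eq_zero_of_not_prime u h2
      rw [this]; exact Nat.zero_le _
  -- back to `ℚ`: `2w + s² + n = C/Q² = u·(b/Q)²`
  refine ⟨u, (b : ℚ) / (Q : ℚ), hu2n, ?_⟩
  have hCq : ((C : ℕ) : ℚ) = 2 * (w * (Q : ℚ) ^ 2) + (s ^ 2 * (Q : ℚ) ^ 2 + n * (Q : ℚ) ^ 2) := by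
    rw [hCdef, hAdef]; push_cast; rw [← hWeq, hsq2]
  have hCq' : ((C : ℕ) : ℚ) = (b : ℚ) ^ 2 * u := by rw [← hCub]; push_cast; ring
  field_simp
  linear_combination hCq.symm.trans hCq'


end Summit.BirchSwinnertonDyer.PrintCf2.InvisibleGenerator

end
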